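import Literature.NumberTheory.EllipticCurves.Rank1Residual.Typed.VisibilityCertificateMultiplicative
import HarnessLib

/-!
# Rank `0`, any class, any image: the typed LOWER half `ord_p #Ш_an ≤ ord_p #Ш` from a VISIBLE element of `Ш(E)[p]` (cell-free doors)

HONEST FRAMING (cells `b2b-bsdres` / `bsd-print-x11a`, verbatim): the goal is to DELETE the
COMBINATION-SHAPED residual classes of the Birch–Swinnerton-Dyer formula for ALL analytic-rank
`≤ 1` elliptic curves over `ℚ` — "full BSD formula for every rank `≤ 1` curve in class C"
assembled STRICTLY from published theorems — so that the rank-`≤ 1` remainder becomes exactly the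
CONSTRUCTION-SHAPED classes, which are TYPED (missing-input `Prop`s), NOT attempted. This is not
"finishing BSD". Theorems only (no definition, no new named fact); PER PAIR certificate doors, NOT
class theorems; nothing is booked by this file.

## What and why

The visibility doors already in the tree (`Typed.bsdp_of_wuthrich_of_congr{,_of_surj}`,
`…_of_congr_of_mult`, `…_of_congr_of_places{,_of_surj}`, `X11RankZero.bsdp_of_congr_of_rank_two`)
all conclude `BSDp W p` and therefore carry the UPPER half as well: Wuthrich 2014 Prop. 21 (`hW`),
hence `p` non-additive and `ρ̄_{E,p}` surjective-or-Borel. What a `p`-congruent curve of rank `≥ 2`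
actually supplies is only the LOWER half — the tree's typed `MissingLowerBoundAt W p`
(`ord_p #Ш(E/ℚ)_an ≤ ord_p #Ш(E/ℚ)`, `Typed/Basic.lean`), which is the currency of the by-name
lower-half cruxes of the BSD ladder (e.g. `ErratumRoadFive.X11aLowerHalf`:
`ClassX11a W p → MissingLowerBoundAt W p`). This file states the doors in that currency, with NO
hypothesis on the image of `ρ̄_{E,p}` beyond `p ∤ #E(ℚ)` and NO hypothesis on the reduction of `E`
at `p` (the kernel visibility count `WeierstrassCurve.exists_sha_ne_zero_of_congr_of_index_lt`
allows `p ∣ N`):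

* `missingLowerBoundAt_of_congr_of_rank_two` — `r_an = 0`, `p` odd, `p ∤ #E(ℚ)`,
  `#Ш_an = q ∈ ℚ` with `ord_p q ≤ 2`, a `Γ_ℚ`-isomorphism `θ : E'[p] ≃ E[p]` from a curve `E'` with
  `rank E'(ℚ) ≥ 2`, a finite set `S` of places (outside: both curves good, `v ∤ p`) with
  `E'(ℚ_v)[p] = 0` on `S` ⇒ `MissingLowerBoundAt W p` (visibility gives `Ш(E)[p] ≠ 0`,
  `exists_sha_ne_zero_of_congr_of_rank`; Cassels–Tate squareness `hCT` turns `p ∣ #Ш` into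
  `p² ∣ #Ш`, `missingLowerBoundAt_of_casselsTate_of_pow_dvd`; `Ш` finite by GZK `hGZK`);
* `missingLowerBoundAt_of_congr_of_places` / `…_of_places_of_irr` — the REFINED count (pay at
  `T ⊆ S`, free kinds elsewhere: `v ∤ p` with `E'(ℚ_v)[p] = 0`; both split multiplicative; both
  multiplicative with `γ(E) = r² γ(E')` and `μ_p(ℚ_v) = 1`), conditional on the two Tate
  uniformisation facts `hU`, `hU2` (`exists_sha_ne_zero_of_congr_of_places`); the `_of_irr` form
  discharges `p ∤ #E(ℚ)` by `E[p]` irreducible (Mazur; `coprime_natCard_point_of_irr`).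

Already in the tree and NOT restated (dedup): the crude count with `E[p]` irreducible,
`Summit.BirchSwinnertonDyer.Rank1Residual.Additive.RankZero.missingLowerBoundAt_of_congr_of_rank_two`
(+ `…_of_primeList`, `…_of_exists_sha_torsion`; `Additive/X4RankZeroVisibleLowerHalfSockets.lean`),
and the composite with Wuthrich's upper half on the surjective non-additive locus,
`bsdp_of_wuthrich_of_congr_of_surj` / `…_of_places_of_surj` (`VisibilityCertificate*.lean`) — so a
record written in the lower-half currency becomes `BSDp` by ONE line
(`bsdp_of_missingLowerBoundAt_of_wuthrich`).

Published inputs (binders): Cassels–Tate (`hCT`), Gross–Zagier–Kolyvagin (`hGZK`); for the refined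
shape Silverman *ATAEC* V.3.1/V.5.3/V.5.4 (`hU`, `hU2`). Per-curve data (displayed): `W'`, `θ`,
`hθ`, `hrank`, `S` (`T`), `hS`, local kinds. Nothing here is new mathematics: it is the gen-9/10
visibility count of `CongruenceVisibility*.lean` read one step earlier, before the upper half.

References: [CremonaMazur2000] §3, Table 1; [AgasheStein2002] Thm. 3.1; [SilvermanAEC2009]
X.4.14, VIII.6; [Mazur1977] III.§5; [Miller2011LMS] Def. 1.1; [SilvermanATAEC1994] V.3.1, V.5.3,
V.5.4; [Wuthrich2014] Prop. 21.
-/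

noncomputable section

open scoped Classical

open WeierstrassCurve Literature.NumberTheory.EllipticCurves
  Literature.NumberTheory.EllipticCurves.Rank1Residual
  Literature.NumberTheory.EllipticCurves.Wuthrich2014
open NumberField IsDedekindDomain

namespace Literature.NumberTheory.EllipticCurves.Rank1Residual.Typed

variable (W : WeierstrassCurve ℚ) [W.IsElliptic] (p : ℕ) [Fact p.Prime]

/-! ### The crude count: `E'(ℚ_v)[p] = 0` on `S`, `rank E'(ℚ) ≥ 2` -/

/-- **Lower half from a visible element, crude count.** `E = W` over `ℚ` of analytic rank `0`,
`p` an odd prime with `p ∤ #E(ℚ)`, `#Ш(E/ℚ)_an = q` rational with `ord_p q ≤ 2`; a `Γ_ℚ`-equivariant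
isomorphism `θ : E'[p] ≃ E[p]` from an elliptic curve `E' = W'` with `rank E'(ℚ) ≥ 2`; a finite set
`S` of finite places outside which both curves have good reduction and `v ∤ p`, with
`E'(ℚ_v)[p] = 0` for `v ∈ S`. Then `ord_p #Ш(E/ℚ)_an ≤ ord_p #Ш(E/ℚ)` (`MissingLowerBoundAt W p`):
visibility (`exists_sha_ne_zero_of_congr_of_rank`, no condition at `p`) gives `Ш(E)[p] ≠ 0`,
Cassels–Tate squareness (`hCT`) gives `p² ∣ #Ш`, `Ш` being finite by Gross–Zagier–Kolyvagin
(`hGZK`). No hypothesis on the image of `ρ̄_{E,p}` or on the reduction of `E` at `p`. PER PAIR; not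
a class theorem. [cite: CremonaMazur2000, §3 and Table 1] [cite: AgasheStein2002, Thm. 3.1]
[cite: SilvermanAEC2009, Thm. X.4.14] [cite: Miller2011LMS, Def. 1.1 (arXiv:1010.2431 p. 3)] -/
theorem missingLowerBoundAt_of_congr_of_rank_two (hCT : exists_casselsTate_pairing (K := ℚ))
    (hGZK : rank_eq_analyticRank_of_analyticRank_le_one) (hp : p ≠ 2) (hr : W.analyticRank = 0)
    (hcop : (Nat.card W.toAffine.Point).Coprime p)
    {q : ℚ} (hq : shaAn W = (q : ℂ)) (hv : padicValRat p q ≤ 2)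
    (W' : WeierstrassCurve ℚ) [W'.IsElliptic]
    (θ : geomTorsion W' (p : ℤ) ≃+ geomTorsion W (p : ℤ))
    (hθ : ∀ (σ : Field.absoluteGaloisGroup ℚ) (P : geomTorsion W' (p : ℤ)), θ (σ • P) = σ • θ P)
    (hrank : 2 ≤ W'.mordellWeilRank) (S : Finset (HeightOneSpectrum (𝓞 ℚ)))
    (hS : ∀ v : HeightOneSpectrum (𝓞 ℚ), v ∉ S →
      W.HasGoodReductionAt v ∧ W'.HasGoodReductionAt v ∧ (p : 𝓞 ℚ) ∉ v.asIdeal)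
    (hloc : ∀ v ∈ S, Nat.card (nsmulAddMonoidHom p :
      (W'.baseChange (v.adicCompletion ℚ)).toAffine.Point →+ _).ker = 1) :
    MissingLowerBoundAt W p := by
  haveI : Finite W.toAffine.Point := finite_point_of_analyticRank_eq_zero W hGZK hr
  have hrank' : Module.finrank ℚ ℚ + 1 ≤ W'.mordellWeilRank := by rwa [Module.finrank_self]
  have hdvd : p ∣ W.shaOrder :=
    dvd_shaOrder_of_exists_torsion W p
      (W.exists_sha_ne_zero_of_congr_of_rank W' hp θ hθ S hS ‹_› hcop hrank' hloc)
  exact missingLowerBoundAt_of_casselsTate_of_pow_dvd W p hCT (hGZK W (by omega)).2 hq (k := 1)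
    (by simpa using hv) (by simpa using hdvd)

/-! ### The refined count: pay at `T ⊆ S`, free kinds elsewhere -/

/-- **Lower half from a visible element, refined count** (pay at the places of `T`, every place of
`S \ T` of a free kind: (i) `v ∤ p` and `E'(ℚ_v)[p] = 0`; (ii) both curves split multiplicative with
`#E(ℚ_v)[p] ≤ p`; (iii) both multiplicative with `γ(E) = r² γ(E')` in `ℚ_v` and `μ_p(ℚ_v) = 1`),
`r_an = 0`, `p` odd, `p ∤ #E(ℚ)`, `ord_p #Ш_an ≤ 2` ⇒ `MissingLowerBoundAt W p`. Conditional on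
Tate's uniformisation (`hU`, `hU2`); Cassels–Tate (`hCT`), GZK (`hGZK`). PER PAIR; not a class
theorem. [cite: CremonaMazur2000, §3 and Table 1] [cite: AgasheStein2002, Thm. 3.1 and §3.5]
[cite: SilvermanATAEC1994, Ch. V Thm. 3.1, Lemma 5.2, Thm. 5.3, Cor. 5.4]
[cite: SilvermanAEC2009, Thm. X.4.14] [cite: Miller2011LMS, Def. 1.1 (arXiv:1010.2431 p. 3)] -/
theorem missingLowerBoundAt_of_congr_of_places (hCT : exists_casselsTate_pairing (K := ℚ))
    (hGZK : rank_eq_analyticRank_of_analyticRank_le_one)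
    (hU : Silverman1994_thmV53_tateUniformisation.{0})
    (hU2 : Silverman1994_thmV53_corV54_tateUniformisation.{0}) (hp : p ≠ 2)
    (hr : W.analyticRank = 0) (hcop : (Nat.card W.toAffine.Point).Coprime p)
    {q : ℚ} (hq : shaAn W = (q : ℂ)) (hv : padicValRat p q ≤ 2)
    (W' : WeierstrassCurve ℚ) [W'.IsElliptic]
    (θ : geomTorsion W' (p : ℤ) ≃+ geomTorsion W (p : ℤ))
    (hθ : ∀ (σ : Field.absoluteGaloisGroup ℚ) (P : geomTorsion W' (p : ℤ)), θ (σ • P) = σ • θ P)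
    (S T : Finset (HeightOneSpectrum (𝓞 ℚ))) (hTS : T ⊆ S)
    (hS : ∀ v : HeightOneSpectrum (𝓞 ℚ), v ∉ S →
      W.HasGoodReductionAt v ∧ W'.HasGoodReductionAt v ∧ (p : 𝓞 ℚ) ∉ v.asIdeal)
    (hT : (∏ v ∈ T, Nat.card (nsmulAddMonoidHom p :
        (W'.baseChange (v.adicCompletion ℚ)).toAffine.Point →+ _).ker *
        Nat.card (v.adicCompletionIntegers ℚ ⧸
          Ideal.span {(p : v.adicCompletionIntegers ℚ)})) < p ^ W'.mordellWeilRank)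
    (hplaces : ∀ v ∈ S, v ∉ T →
      ((p : 𝓞 ℚ) ∉ v.asIdeal ∧ Nat.card (nsmulAddMonoidHom p :
          (W'.baseChange (v.adicCompletion ℚ)).toAffine.Point →+ _).ker = 1) ∨
      (W.HasSplitMultiplicativeReductionAt v ∧ W'.HasSplitMultiplicativeReductionAt v ∧
        Nat.card (nsmulAddMonoidHom p :
          (W.baseChange (v.adicCompletion ℚ)).toAffine.Point →+ _).ker ≤ p) ∨
      (W.HasMultiplicativeReductionAt v ∧ W'.HasMultiplicativeReductionAt v ∧
        (∃ r : v.adicCompletion ℚ, algebraMap ℚ (v.adicCompletion ℚ) (-(W.c₄ / W.c₆)) =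
          r ^ 2 * algebraMap ℚ (v.adicCompletion ℚ) (-(W'.c₄ / W'.c₆))) ∧
        (∀ ζ : v.adicCompletion ℚ, ζ ^ p = 1 → ζ = 1))) :
    MissingLowerBoundAt W p := by
  haveI : Finite W.toAffine.Point := finite_point_of_analyticRank_eq_zero W hGZK hr
  have hdvd : p ∣ W.shaOrder :=
    dvd_shaOrder_of_exists_torsion W p
      (W.exists_sha_ne_zero_of_congr_of_places hU hU2 hp W' θ hθ S T hTS hS ‹_› hcop hT hplaces)
  exact missingLowerBoundAt_of_casselsTate_of_pow_dvd W p hCT (hGZK W (by omega)).2 hq (k := 1)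
    (by simpa using hv) (by simpa using hdvd)

/-- **Lower half from a visible element, refined count, `E[p]` irreducible** (`p ∤ #E(ℚ)`
automatic). PER PAIR; not a class theorem. [cite: CremonaMazur2000, §3 and Table 1]
[cite: Mazur1977, Ch. III §5, p. 157] [cite: SilvermanATAEC1994, Ch. V Thm. 5.3, Cor. 5.4]
[cite: SilvermanAEC2009, Thm. X.4.14] [cite: Miller2011LMS, Def. 1.1 (arXiv:1010.2431 p. 3)] -/
theorem missingLowerBoundAt_of_congr_of_places_of_irr (hCT : exists_casselsTate_pairing (K := ℚ))
    (hGZK : rank_eq_analyticRank_of_analyticRank_le_one)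
    (hU : Silverman1994_thmV53_tateUniformisation.{0})
    (hU2 : Silverman1994_thmV53_corV54_tateUniformisation.{0}) (hp : p ≠ 2)
    (hr : W.analyticRank = 0) (hirr : Irr W p)
    {q : ℚ} (hq : shaAn W = (q : ℂ)) (hv : padicValRat p q ≤ 2)
    (W' : WeierstrassCurve ℚ) [W'.IsElliptic]
    (θ : geomTorsion W' (p : ℤ) ≃+ geomTorsion W (p : ℤ))
    (hθ : ∀ (σ : Field.absoluteGaloisGroup ℚ) (P : geomTorsion W' (p : ℤ)), θ (σ • P) = σ • θ P)
    (S T : Finset (HeightOneSpectrum (𝓞 ℚ))) (hTS : T ⊆ S)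
    (hS : ∀ v : HeightOneSpectrum (𝓞 ℚ), v ∉ S →
      W.HasGoodReductionAt v ∧ W'.HasGoodReductionAt v ∧ (p : 𝓞 ℚ) ∉ v.asIdeal)
    (hT : (∏ v ∈ T, Nat.card (nsmulAddMonoidHom p :
        (W'.baseChange (v.adicCompletion ℚ)).toAffine.Point →+ _).ker *
        Nat.card (v.adicCompletionIntegers ℚ ⧸
          Ideal.span {(p : v.adicCompletionIntegers ℚ)})) < p ^ W'.mordellWeilRank)
    (hplaces : ∀ v ∈ S, v ∉ T →
      ((p : 𝓞 ℚ) ∉ v.asIdeal ∧ Nat.card (nsmulAddMonoidHom p :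
          (W'.baseChange (v.adicCompletion ℚ)).toAffine.Point →+ _).ker = 1) ∨
      (W.HasSplitMultiplicativeReductionAt v ∧ W'.HasSplitMultiplicativeReductionAt v ∧
        Nat.card (nsmulAddMonoidHom p :
          (W.baseChange (v.adicCompletion ℚ)).toAffine.Point →+ _).ker ≤ p) ∨
      (W.HasMultiplicativeReductionAt v ∧ W'.HasMultiplicativeReductionAt v ∧
        (∃ r : v.adicCompletion ℚ, algebraMap ℚ (v.adicCompletion ℚ) (-(W.c₄ / W.c₆)) =
          r ^ 2 * algebraMap ℚ (v.adicCompletion ℚ) (-(W'.c₄ / W'.c₆))) ∧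
        (∀ ζ : v.adicCompletion ℚ, ζ ^ p = 1 → ζ = 1))) :
    MissingLowerBoundAt W p := by
  haveI : Finite W.toAffine.Point := finite_point_of_analyticRank_eq_zero W hGZK hr
  exact missingLowerBoundAt_of_congr_of_places W p hCT hGZK hU hU2 hp hr
    (coprime_natCard_point_of_irr W p hirr) hq hv W' θ hθ S T hTS hS hT hplaces

end Literature.NumberTheory.EllipticCurves.Rank1Residual.Typed

end
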